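import Literature.NumberTheory.Automorphic.UnitaryGroupFormTransport      -- ★ `formCongr`, `conj_mem_unitaryGroupOfForm`
import HarnessLib

/-!
# Eigenvectors and hermitian values under a change of basis `T` with `σ(T)ᵀ Φ T = H`
(Platonov–Rapinchuk 1994 §2.3: equivalent forms give conjugate unitary groups; Rogawski 1990 §14.2 p. 233 «`K_v ≃ K′_v`»)

Topic `NumberTheory/Automorphic`; namespace `Literature.NumberTheory.Automorphic`.  THEOREMS ONLY (no definition, no instance, no notation, no named fact, no `sorry`);
any commutative ring `R` with an endomorphism `σ`.  Cell `pub/hodgecm-mathlib`, road «N7-ns COUNT FROM FLICKER», line «N7nsCount», `stub_irredGValuePos` (:1189): the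
algebra of brick (γ) of LEAD F0P3a-plan (g9) T8-131 — when the value stub's `δ ∈ U(H′_v)` is carried to `t = Tl δ Tl⁻¹ ∈ U(Φ₃)` by a congruence `formCongr σ Tl Φ₃ = H′_v`
(p04's ★ `…SplitClauseOfValuesStubFrame` grammar), a `u`-eigenvector `p′` of `δ` goes to the `u`-eigenvector `Tl p′` of `t`, and its `Φ₃`-value EQUALS the `H′_v`-value of
`p′` (so «even order», ★ B-p12 `even_log_valued_of_finKappaAt_eq_one`, is preserved and feeds `hx` of ★ B-p12 `natCard_fixedPoints_unitaryInt_eq_phiTHn_of_eigen`).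
HONEST LABEL: HC_CM is proved only modulo the printed citations (2 remaining named inputs hLiu418, h413) until rung 0 closes; bookkeeping.

## References
* [PlatonovRapinchuk1994] V. Platonov, A. Rapinchuk, *Algebraic Groups and Number Theory* (1994), §2.3.
* [Rogawski1990] J. D. Rogawski, *Automorphic Representations of Unitary Groups in Three Variables* (1990), §14.2 p. 233, §4.3 p. 43.
-/

set_option autoImplicit false

open scoped Matrix MatrixGroups

namespace Literature.NumberTheory.Automorphic

section Transport

variable {R : Type*} [CommRing R] {n : Type*} [Fintype n] [DecidableEq n] (σ : R →+* R)

/-- **Eigenvectors transport**: `g p = u p ⇒ (T g T⁻¹)(T p) = u (T p)`. [cite: PlatonovRapinchuk1994, §2.3] -/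
theorem conj_mulVec_mulVec_eq_smul (T : GL n R) {g : Matrix n n R} {p : n → R} {u : R} (hp : g *ᵥ p = u • p) :
    ((T : Matrix n n R) * g * ((T⁻¹ : GL n R) : Matrix n n R)) *ᵥ ((T : Matrix n n R) *ᵥ p) = u • ((T : Matrix n n R) *ᵥ p) := by
  have h1 : ((T⁻¹ : GL n R) : Matrix n n R) * (T : Matrix n n R) = 1 := by rw [← Units.val_mul, inv_mul_cancel, Units.val_one]
  rw [← Matrix.mulVec_mulVec, ← Matrix.mulVec_mulVec, Matrix.mulVec_mulVec _ ((T⁻¹ : GL n R) : Matrix n n R), h1, Matrix.one_mulVec, hp,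
    Matrix.mulVec_smul]

/-- `T p ≠ 0` when `p ≠ 0` (`T` invertible). [cite: PlatonovRapinchuk1994, §2.3] -/
theorem mulVec_ne_zero_of_ne_zero (T : GL n R) {p : n → R} (hp : p ≠ 0) : (T : Matrix n n R) *ᵥ p ≠ 0 := by
  intro h0
  apply hp
  have h1 : ((T⁻¹ : GL n R) : Matrix n n R) * (T : Matrix n n R) = 1 := by rw [← Units.val_mul, inv_mul_cancel, Units.val_one]
  have := congrArg (fun x => ((T⁻¹ : GL n R) : Matrix n n R) *ᵥ x) h0
  simpa only [Matrix.mulVec_mulVec, h1, Matrix.one_mulVec, Matrix.mulVec_zero] using this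

/-- **Hermitian values transport**: with `H = σ(T)ᵀ Φ T` (`formCongr σ T Φ = H`), the `Φ`-value of `T p` is the `H`-value of `p`:
`Σᵢₖ σ((Tp)ᵢ) Φᵢₖ (Tp)ₖ = Σᵢₖ σ(pᵢ) Hᵢₖ pₖ`. [cite: PlatonovRapinchuk1994, §2.3] [cite: Rogawski1990, §4.3 p. 43] -/
theorem sum_map_mulVec_mul_mulVec_eq_of_formCongr_eq (T : GL n R) {Φ H : Matrix n n R} (hT : formCongr σ T Φ = H) (p : n → R) :
    ∑ i, ∑ k, σ (((T : Matrix n n R) *ᵥ p) i) * Φ i k * ((T : Matrix n n R) *ᵥ p) k = ∑ i, ∑ k, σ (p i) * H i k * p k := by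
  -- both sides are `σ(p) ⬝ (M p)` for `M = σ(T)ᵀ Φ T = H`
  have key : ∀ (M : Matrix n n R) (q : n → R), ∑ i, ∑ k, σ (q i) * M i k * q k = (fun i => σ (q i)) ⬝ᵥ (M *ᵥ q) := by
    intro M q
    simp only [dotProduct, Matrix.mulVec, Finset.mul_sum, mul_assoc]
  rw [key, key, ← hT]
  -- `σ(Tp) ⬝ Φ (Tp) = σ p ⬝ (σ(T)ᵀ Φ T) p`
  have hσTp : (fun i => σ (((T : Matrix n n R) *ᵥ p) i)) = ((T : Matrix n n R).map σ) *ᵥ fun i => σ (p i) := by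
    ext i
    simp only [Matrix.mulVec, dotProduct, map_sum, map_mul, Matrix.map_apply]
  rw [hσTp, ← Matrix.vecMul_transpose, ← Matrix.dotProduct_mulVec]
  show _ = (fun i => σ (p i)) ⬝ᵥ ((((T : Matrix n n R).map σ)ᵀ * Φ * (T : Matrix n n R)) *ᵥ p)
  rw [← Matrix.mulVec_mulVec, ← Matrix.mulVec_mulVec]

end Transport

end Literature.NumberTheory.Automorphic
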